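import Mathlib
import HarnessLib
import Summits.AtomisticToContinuum.Crystallization.Theorems.PricedLinkCensusSoftFourRingsEndgameReduction
import Summits.AtomisticToContinuum.Crystallization.Theorems.PricedLinkCensusSoftFourRingsRigFinal
import Summits.AtomisticToContinuum.Crystallization.Theorems.PricedLinkCensusSoftFourRingsRigCheckFcc
import Summits.AtomisticToContinuum.Crystallization.Theorems.PricedLinkCensusSoftFourRingsRigCheckHcp1
import Summits.AtomisticToContinuum.Crystallization.Theorems.PricedLinkCensusSoftFourRingsRigCheckHcp2

/-!
# Soft four-rings, metric half by certified numerics (15): labelled rigidity, and `SoftFourRings` from Tammes-13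

Route `PricedLinkCensus`, sub-problem `Crystallization`, item `SoftFourRings`
(stmt-AtomisticToContinuum-14234).  The two certificate streams pass `checkAll` (`…RigCheckFcc`, `…RigCheckHcp1/2`), whence **`labelledRigidity_holds : LabelledRigidity (6/25)`** by `labelledRigidity_of_checkAll` (`…RigFinal`), and the route's `SoftFourRings` conditional only on the Tammes-13 fact (`softFourRings_of_tammes13`, via `softFourRings_of_labelledRigidity` of `…EndgameReduction`).
-/

namespace Summit.AtomisticToContinuum.Crystallization.Theorems

open Literature.Geometry.DiscreteGeometry

namespace Rig

/-- **The HCP certificate stream passes the check.** -/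
theorem hcp_checkAll : checkAll hcpModel hcpCells = true := by
  have h : hcpCells.all (runCell hcpModel) = true := by
    rw [← List.take_append_drop 83 hcpCells, List.all_append, hcp_all_take, hcp_all_drop]; rfl
  have hc := hcp_covers
  unfold checkAll
  rw [h, hc]; rfl

/-- **Labelled rigidity at `δ = 6/25`.** -/
theorem labelledRigidity_holds : LabelledRigidity (6 / 25) :=
  labelledRigidity_of_checkAll fcc_checkAll hcp_checkAll

end Rig

/-- **`SoftFourRings` from the Tammes-13 fact** (Musin–Tarasov 2012): the labelled-rigidity
hypothesis of `softFourRings_of_labelledRigidity` is discharged by `Rig.labelledRigidity_holds`,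
so the route's `SoftFourRings` holds conditionally on `musinTarasov2012_tammes_thirteen` alone. -/
theorem softFourRings_of_tammes13 (hT : musinTarasov2012_tammes_thirteen) :
    Summit.AtomisticToContinuum.Crystallization.Theses.PricedLinkCensus.SoftFourRings :=
  softFourRings_of_labelledRigidity hT le_rfl Rig.labelledRigidity_holds

end Summit.AtomisticToContinuum.Crystallization.Theorems
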